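import Summits.CriticalPhenomena.PercolationContinuityZ3.Theorems.PercNearOneGluingNoHeavyLowerTailSahiDefectExpansion
import Mathlib.Tactic.Linarith
import HarnessLib

/-!
# `NoHeavyLowerTail` (stmt-CriticalPhenomena-4575) — the FULL all-order defect certificate for Sahi's `E_n`

Support file, seat `prim-l12-p5` (gen 4), `--supports stmt-CriticalPhenomena-4575`.  No definitions, no named facts, no sorries.
Refines the certificates of `…SahiDefectExpansion` (`sahiE_cons_ge_defect`: drop all middle blocks; `sahiE_cons_ge_defect_sharp`: keep the blocks with
`|Tᶜ| = 1`): in the defect expansion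
`E_{m+2}(d, g) = (m + 1 − E d)·E_{m+1}(g) + Σ_{∅≠T⊊univ} |T|!·E[(1−d)∏_T g]·E(g|Tᶜ) − (m+1)!·E[(1−d)∏ g]`
EVERY block defect dominates the top defect, `E[(1−d)∏_T g] ≥ E[(1−d)∏_{all} g]` (`defect_top_le_defect`, slots in `[0,1]`, `d ≤ 1`), so with
hereditarily nonnegative sub-families

  `E_{m+2}(d, g) ≥ (m + 1 − E d)·E_{m+1}(g) − E[(1−d)∏ g]·((m+1)! − Σ_{∅≠T⊊univ} |T|!·E(g|Tᶜ))`   (`sahiE_cons_ge_defect_full`).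

Census use (seat `code/g4/fourwise_core_k5.py`, `en_calc.py`): on the fourwise hard core of `{0,1}^4` (0.27 % of the quadruples of up-sets) the sharp
certificate already certifies 96 % at `q ≡ 1/2`; on `{0,1}^5` (5.2 % of quadruples non-absorbing) sharp and full certify 100 % of a 3 095-sample at
`q ∈ {1/4, 1/2, 3/4}` — the residual fourth-order content sits next to the independent locus `E₄ ≡ 0`.
-/

namespace Summit.CriticalPhenomena.PercolationContinuityZ3.Theorems

namespace SahiDefectExpansion

open Finset Function Literature.Combinatorics.Sahi2008 SahiMomentExpansion
open scoped Nat

variable {α : Type*} [Fintype α]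

/-! ### The full all-order defect certificate -/

section FullCertificate

omit [Fintype α] in
/-- Pointwise: dropping `[0,1]`-valued factors can only increase a product — `(1−d)·∏_{all} g ≤ (1−d)·∏_{i∈T} g`. [folklore] -/
theorem defect_top_le_defect {N : ℕ} (g : Fin N → α → ℝ) (hg0 : ∀ i a, 0 ≤ g i a) (hg1 : ∀ i a, g i a ≤ 1)
    (d : α → ℝ) (hd : ∀ a, d a ≤ 1) (T : Finset (Fin N)) (a : α) :
    ((1 - d) * ∏ i, g i) a ≤ ((1 - d) * ∏ i ∈ T, g i) a := by
  simp only [Pi.mul_apply, Pi.sub_apply, Pi.one_apply, Finset.prod_apply]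
  refine mul_le_mul_of_nonneg_left ?_ (sub_nonneg.mpr (hd a))
  rw [← Finset.prod_sdiff (Finset.subset_univ T)]
  exact mul_le_of_le_one_left (Finset.prod_nonneg fun i _ => hg0 i a)
    (Finset.prod_le_one (fun i _ => hg0 i a) fun i _ => hg1 i a)

/-- **Full all-order defect certificate.**  Nonnegative weight, `0 ≤ g_i ≤ 1`, `d ≤ 1`, every sub-family `g|S` (`1 ≤ |S| ≤ m`) with `E ≥ 0`:
`E_{m+2}(d, g) ≥ (m + 1 − E d)·E_{m+1}(g) − E[(1−d)∏ g]·((m+1)! − Σ_{∅≠T⊊univ} |T|!·E(g|Tᶜ))` — every block's defect `E[(1−d)∏_T g]` dominates the top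
defect.  Refines `sahiE_cons_ge_defect` (drop the sum) and `sahiE_cons_ge_defect_sharp` (keep only `|Tᶜ| = 1`). [this file] -/
theorem sahiE_cons_ge_defect_full {μ : α → ℝ} (hμ : ∀ a, 0 ≤ μ a) (m : ℕ) (d : α → ℝ) (g : Fin (m + 1) → α → ℝ)
    (hg0 : ∀ i a, 0 ≤ g i a) (hg1 : ∀ i a, g i a ≤ 1) (hd : ∀ a, d a ≤ 1)
    (hsub : ∀ T : Finset (Fin (m + 1)), T.Nonempty → T ≠ univ →
      0 ≤ sahiE μ Tᶜ.card (fun j => g (Tᶜ.orderEmbOfFin rfl j))) :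
    (((m : ℝ) + 1) - ex μ d) * sahiE μ (m + 1) g
        - ex μ ((1 - d) * ∏ i, g i) * (((m + 1)! : ℝ)
          - ∑ T : Finset (Fin (m + 1)) with (T.Nonempty ∧ T ≠ univ),
              ((T.card)! : ℝ) * sahiE μ Tᶜ.card (fun j => g (Tᶜ.orderEmbOfFin rfl j)))
      ≤ sahiE μ (m + 2) (Fin.cons d g : Fin (m + 2) → α → ℝ) := by
  rw [sahiE_cons_eq_defect_expansion]
  have hterm : ∀ T ∈ (univ : Finset (Finset (Fin (m + 1)))).filter (fun T => T.Nonempty ∧ T ≠ univ),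
      ex μ ((1 - d) * ∏ i, g i) * (((T.card)! : ℝ) * sahiE μ Tᶜ.card (fun j => g (Tᶜ.orderEmbOfFin rfl j)))
        ≤ ((T.card)! : ℝ) * (ex μ ((1 - d) * ∏ i ∈ T, g i) * sahiE μ Tᶜ.card (fun j => g (Tᶜ.orderEmbOfFin rfl j))) := by
    intro T hT
    have hT' := (Finset.mem_filter.mp hT).2
    have hE := hsub T hT'.1 hT'.2
    have hle : ex μ ((1 - d) * ∏ i, g i) ≤ ex μ ((1 - d) * ∏ i ∈ T, g i) :=
      ex_mono hμ fun a => defect_top_le_defect g hg0 hg1 d hd T a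
    have := mul_le_mul_of_nonneg_right hle (mul_nonneg (Nat.cast_nonneg (T.card)!) hE)
    nlinarith [this]
  have hS := Finset.sum_le_sum hterm
  rw [← Finset.mul_sum] at hS
  nlinarith [hS]

end FullCertificate

end SahiDefectExpansion

end Summit.CriticalPhenomena.PercolationContinuityZ3.Theorems
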